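import Summits.ResolutionOfSingularities.ResolutionOfSingularities.Theorems.FrobeniusLadderFRationalResolutionFreeChartOfMatrix
import HarnessLib

/-!
# Crux `FrobeniusLadder.FRationalResolution` (stmt-ResolutionOfSingularities-15317), line `redirect`,
# stub `stub_diagonalizableQuotientResolution` — THE FIVE VERTEX CHARTS OF THE THREEFOLD CLASS `1/3(1,1,2)` (all free)

For the weight kernel `P = {m ∈ ℕ³ : 3 ∣ m₀ + m₁ + 2m₂} = ⟨G⟩`, `G = {(3,0,0),(0,3,0),(0,0,3),(1,0,1),(0,1,1),(2,1,0),(1,2,0)}`, the Newton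
vertices are the first five generators and every vertex chart is FREE (`ℕ³`, integer matrices of determinant `±3`). One lemma per vertex
(own heartbeat budget), each an instance of `…FreeChartOfMatrix.freeChart_of_matrixHom` (p844132) with the generator checks verified by
`simp`; the data were found and checked by the script `gen/class3.py` of the session folder. Consumed by `…ClassOneThird112`.

* `chart_a`, `chart_b`, `chart_c`, `chart_d`, `chart_e` — the per-vertex slots at `(3,0,0)`, `(0,3,0)`, `(0,0,3)`, `(1,0,1)`, `(0,1,1)`.

Honest label: combinatorial helper toward ONE leaf stub (no stub, crux or summit closed). No definitions, no named facts, no sorry.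
[folklore; cite: CoxLittleSchenck2011, §1.2, §11.4]
-/

noncomputable section

-- single-problem summit: the doubled namespace component is forced
set_option linter.dupNamespace false

open CategoryTheory AlgebraicGeometry TopologicalSpace IsLocalRing
open Literature.AlgebraicGeometry.Resolution

namespace Summit.ResolutionOfSingularities.ResolutionOfSingularities.Theorems.FRationalResolution.ClassOneThird112

open ConeCertificateGenerators

/-- The exponent of `p ∈ ℕⁿ` in `ℤⁿ`. -/
local notation3 (prettyPrint := false) "toZ[" n "]" =>
  (Finsupp.mapRange.addMonoidHom (Nat.castAddMonoidHom ℤ) : (Fin n →₀ ℕ) →+ (Fin n →₀ ℤ))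

/-- The Hilbert basis of `1/3(1,1,2)`. -/
local notation3 (prettyPrint := false) "G7" => ({Finsupp.single 0 3, Finsupp.single 1 3, Finsupp.single 2 3, Finsupp.single 0 1 + Finsupp.single 2 1, Finsupp.single 1 1 + Finsupp.single 2 1, Finsupp.single 0 2 + Finsupp.single 1 1, Finsupp.single 0 1 + Finsupp.single 1 2} : Set (Fin 3 →₀ ℕ))

/-- **The vertex chart of `1/3(1,1,2)` at `(3,0,0)`**: free, basis `[[3, 0, 0], [-2, 0, 1], [-1, 1, 0]]`. [folklore; cite: CoxLittleSchenck2011, §1.2] -/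
theorem chart_a (P : AddSubmonoid (Fin 3 →₀ ℕ)) (hGP : AddSubmonoid.closure G7 = P) (gen : Fin 7 → ↥P)
    (hgen0 : ((gen 0 : ↥P) : Fin 3 →₀ ℕ) = (Finsupp.single 0 3 : Fin 3 →₀ ℕ))
    (_hgen1 : ((gen 1 : ↥P) : Fin 3 →₀ ℕ) = (Finsupp.single 1 3 : Fin 3 →₀ ℕ))
    (_hgen2 : ((gen 2 : ↥P) : Fin 3 →₀ ℕ) = (Finsupp.single 2 3 : Fin 3 →₀ ℕ))
    (hgen3 : ((gen 3 : ↥P) : Fin 3 →₀ ℕ) = (Finsupp.single 0 1 + Finsupp.single 2 1 : Fin 3 →₀ ℕ))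
    (_hgen4 : ((gen 4 : ↥P) : Fin 3 →₀ ℕ) = (Finsupp.single 1 1 + Finsupp.single 2 1 : Fin 3 →₀ ℕ))
    (hgen5 : ((gen 5 : ↥P) : Fin 3 →₀ ℕ) = (Finsupp.single 0 2 + Finsupp.single 1 1 : Fin 3 →₀ ℕ))
    (_hgen6 : ((gen 6 : ↥P) : Fin 3 →₀ ℕ) = (Finsupp.single 0 1 + Finsupp.single 1 2 : Fin 3 →₀ ℕ))
    (hgen0' : ∀ j, gen j ≠ 0) :
    ∃ (n' : ℕ) (Q : AddSubmonoid (Fin n' →₀ ℕ)) (ι : ↥Q →+ (Fin 3 →₀ ℤ)) (_ : Function.Injective ι)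
      (_ : ∀ e : ↥P, e ≠ 0 → ∃ u : ↥Q, ι u = toZ[3] (e : Fin 3 →₀ ℕ) - toZ[3] ((gen 0 : ↥P) : Fin 3 →₀ ℕ))
      (_ : ∀ p : ↥P, ∃ u : ↥Q, ι u = toZ[3] (p : Fin 3 →₀ ℕ))
      (_ : ∀ u : ↥Q, ∃ (p : ↥P) (r : ℕ) (e : Fin r → ↥P), (∀ i, e i ≠ 0) ∧
        ι u = toZ[3] (p : Fin 3 →₀ ℕ) + ∑ i, (toZ[3] ((e i : ↥P) : Fin 3 →₀ ℕ) - toZ[3] ((gen 0 : ↥P) : Fin 3 →₀ ℕ))),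
      (∀ (κ : Type) [Field κ], IsRegularRing (AddMonoidAlgebra κ ↥Q)) ∨
      ∃ (GQ : Set (Fin n' →₀ ℕ)) (_ : GQ.Finite) (_ : (0 : Fin n' →₀ ℕ) ∉ GQ) (_ : AddSubmonoid.closure GQ = Q),
        (∀ (κ : Type) [Field κ], ∀ u : ↥Q, (u : Fin n' →₀ ℕ) ∈ GQ →
          IsRegularRing (Localization.Away (AddMonoidAlgebra.single u (1 : κ)))) ∧
        (∀ (K : Type) [Field K], Scheme.IsRegular (affineBlowup (Ideal.span {w : ↥(Algebra.adjoin K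
          ((fun d : Fin n' →₀ ℕ => MvPolynomial.monomial d (1 : K)) '' GQ)) |
          ∃ d ∈ GQ, (w : MvPolynomial (Fin n') K) = MvPolynomial.monomial d 1}))) := by
  obtain ⟨L, hLM⟩ := exists_matrixHom (n := 3) (n' := 3) ![![3, 0, 0], ![-2, 0, 1], ![-1, 1, 0]]
  have hLinj : Function.Injective L := by
    intro u u' h
    have h0 := DFunLike.congr_fun h 0
    have h1 := DFunLike.congr_fun h 1
    have h2 := DFunLike.congr_fun h 2
    simp [hLM, Fin.sum_univ_three] at h0 h1 h2
    have e0 : u 0 = u' 0 := by omega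
    have e1 : u 1 = u' 1 := by omega
    have e2 : u 2 = u' 2 := by omega
    ext kk
    fin_cases kk
    exacts [e0, e1, e2]
  refine freeChart_of_matrixHom P G7 hGP (gen 0) L hLinj ?_ ?_ ?_
  · rintro g (rfl | rfl | rfl | rfl | rfl | rfl | rfl)
    · exact ⟨(Finsupp.single 0 1 : Fin 3 →₀ ℕ), by ext kk; fin_cases kk <;> simp [hLM, Fin.sum_univ_three] ⟩
    · exact ⟨(Finsupp.single 0 1 + Finsupp.single 2 3 : Fin 3 →₀ ℕ), by ext kk; fin_cases kk <;> simp [hLM, Fin.sum_univ_three] ⟩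
    · exact ⟨(Finsupp.single 0 2 + Finsupp.single 1 3 : Fin 3 →₀ ℕ), by ext kk; fin_cases kk <;> simp [hLM, Fin.sum_univ_three] ⟩
    · exact ⟨(Finsupp.single 0 1 + Finsupp.single 1 1 : Fin 3 →₀ ℕ), by ext kk; fin_cases kk <;> simp [hLM, Fin.sum_univ_three] ⟩
    · exact ⟨(Finsupp.single 0 1 + Finsupp.single 1 1 + Finsupp.single 2 1 : Fin 3 →₀ ℕ), by ext kk; fin_cases kk <;> simp [hLM, Fin.sum_univ_three] ⟩
    · exact ⟨(Finsupp.single 0 1 + Finsupp.single 2 1 : Fin 3 →₀ ℕ), by ext kk; fin_cases kk <;> simp [hLM, Fin.sum_univ_three] ⟩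
    · exact ⟨(Finsupp.single 0 1 + Finsupp.single 2 2 : Fin 3 →₀ ℕ), by ext kk; fin_cases kk <;> simp [hLM, Fin.sum_univ_three] ⟩
  · rintro g (rfl | rfl | rfl | rfl | rfl | rfl | rfl)
    · exact ⟨0, by rw [map_zero, hgen0, sub_self]⟩
    · exact ⟨(Finsupp.single 2 3 : Fin 3 →₀ ℕ), by ext kk; fin_cases kk <;> simp [hLM, Fin.sum_univ_three, hgen0] ⟩
    · exact ⟨(Finsupp.single 0 1 + Finsupp.single 1 3 : Fin 3 →₀ ℕ), by ext kk; fin_cases kk <;> simp [hLM, Fin.sum_univ_three, hgen0] ⟩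
    · exact ⟨(Finsupp.single 1 1 : Fin 3 →₀ ℕ), by ext kk; fin_cases kk <;> simp [hLM, Fin.sum_univ_three, hgen0] ⟩
    · exact ⟨(Finsupp.single 1 1 + Finsupp.single 2 1 : Fin 3 →₀ ℕ), by ext kk; fin_cases kk <;> simp [hLM, Fin.sum_univ_three, hgen0] ⟩
    · exact ⟨(Finsupp.single 2 1 : Fin 3 →₀ ℕ), by ext kk; fin_cases kk <;> simp [hLM, Fin.sum_univ_three, hgen0] ⟩
    · exact ⟨(Finsupp.single 2 2 : Fin 3 →₀ ℕ), by ext kk; fin_cases kk <;> simp [hLM, Fin.sum_univ_three, hgen0] ⟩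
  · intro i
    fin_cases i
    · refine ⟨gen 0, 0, Fin.elim0, fun l => l.elim0, ?_⟩
      rw [Finset.univ_eq_empty, Finset.sum_empty, add_zero]
      ext kk; fin_cases kk <;> simp [hLM, Fin.sum_univ_three, hgen0]
    · refine ⟨0, 1, ![gen 3], fun l => by fin_cases l; exact hgen0' _, ?_⟩
      rw [Fin.sum_univ_one]
      ext kk; fin_cases kk <;> simp [hLM, Fin.sum_univ_three, hgen0, hgen3]
    · refine ⟨0, 1, ![gen 5], fun l => by fin_cases l; exact hgen0' _, ?_⟩
      rw [Fin.sum_univ_one]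
      ext kk; fin_cases kk <;> simp [hLM, Fin.sum_univ_three, hgen0, hgen5]

/-- **The vertex chart of `1/3(1,1,2)` at `(0,3,0)`**: free, basis `[[0, 3, 0], [0, -2, 1], [1, -1, 0]]`. [folklore; cite: CoxLittleSchenck2011, §1.2] -/
theorem chart_b (P : AddSubmonoid (Fin 3 →₀ ℕ)) (hGP : AddSubmonoid.closure G7 = P) (gen : Fin 7 → ↥P)
    (_hgen0 : ((gen 0 : ↥P) : Fin 3 →₀ ℕ) = (Finsupp.single 0 3 : Fin 3 →₀ ℕ))
    (hgen1 : ((gen 1 : ↥P) : Fin 3 →₀ ℕ) = (Finsupp.single 1 3 : Fin 3 →₀ ℕ))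
    (_hgen2 : ((gen 2 : ↥P) : Fin 3 →₀ ℕ) = (Finsupp.single 2 3 : Fin 3 →₀ ℕ))
    (_hgen3 : ((gen 3 : ↥P) : Fin 3 →₀ ℕ) = (Finsupp.single 0 1 + Finsupp.single 2 1 : Fin 3 →₀ ℕ))
    (hgen4 : ((gen 4 : ↥P) : Fin 3 →₀ ℕ) = (Finsupp.single 1 1 + Finsupp.single 2 1 : Fin 3 →₀ ℕ))
    (_hgen5 : ((gen 5 : ↥P) : Fin 3 →₀ ℕ) = (Finsupp.single 0 2 + Finsupp.single 1 1 : Fin 3 →₀ ℕ))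
    (hgen6 : ((gen 6 : ↥P) : Fin 3 →₀ ℕ) = (Finsupp.single 0 1 + Finsupp.single 1 2 : Fin 3 →₀ ℕ))
    (hgen0' : ∀ j, gen j ≠ 0) :
    ∃ (n' : ℕ) (Q : AddSubmonoid (Fin n' →₀ ℕ)) (ι : ↥Q →+ (Fin 3 →₀ ℤ)) (_ : Function.Injective ι)
      (_ : ∀ e : ↥P, e ≠ 0 → ∃ u : ↥Q, ι u = toZ[3] (e : Fin 3 →₀ ℕ) - toZ[3] ((gen 1 : ↥P) : Fin 3 →₀ ℕ))
      (_ : ∀ p : ↥P, ∃ u : ↥Q, ι u = toZ[3] (p : Fin 3 →₀ ℕ))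
      (_ : ∀ u : ↥Q, ∃ (p : ↥P) (r : ℕ) (e : Fin r → ↥P), (∀ i, e i ≠ 0) ∧
        ι u = toZ[3] (p : Fin 3 →₀ ℕ) + ∑ i, (toZ[3] ((e i : ↥P) : Fin 3 →₀ ℕ) - toZ[3] ((gen 1 : ↥P) : Fin 3 →₀ ℕ))),
      (∀ (κ : Type) [Field κ], IsRegularRing (AddMonoidAlgebra κ ↥Q)) ∨
      ∃ (GQ : Set (Fin n' →₀ ℕ)) (_ : GQ.Finite) (_ : (0 : Fin n' →₀ ℕ) ∉ GQ) (_ : AddSubmonoid.closure GQ = Q),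
        (∀ (κ : Type) [Field κ], ∀ u : ↥Q, (u : Fin n' →₀ ℕ) ∈ GQ →
          IsRegularRing (Localization.Away (AddMonoidAlgebra.single u (1 : κ)))) ∧
        (∀ (K : Type) [Field K], Scheme.IsRegular (affineBlowup (Ideal.span {w : ↥(Algebra.adjoin K
          ((fun d : Fin n' →₀ ℕ => MvPolynomial.monomial d (1 : K)) '' GQ)) |
          ∃ d ∈ GQ, (w : MvPolynomial (Fin n') K) = MvPolynomial.monomial d 1}))) := by
  obtain ⟨L, hLM⟩ := exists_matrixHom (n := 3) (n' := 3) ![![0, 3, 0], ![0, -2, 1], ![1, -1, 0]]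
  have hLinj : Function.Injective L := by
    intro u u' h
    have h0 := DFunLike.congr_fun h 0
    have h1 := DFunLike.congr_fun h 1
    have h2 := DFunLike.congr_fun h 2
    simp [hLM, Fin.sum_univ_three] at h0 h1 h2
    have e0 : u 0 = u' 0 := by omega
    have e1 : u 1 = u' 1 := by omega
    have e2 : u 2 = u' 2 := by omega
    ext kk
    fin_cases kk
    exacts [e0, e1, e2]
  refine freeChart_of_matrixHom P G7 hGP (gen 1) L hLinj ?_ ?_ ?_
  · rintro g (rfl | rfl | rfl | rfl | rfl | rfl | rfl)
    · exact ⟨(Finsupp.single 0 1 + Finsupp.single 2 3 : Fin 3 →₀ ℕ), by ext kk; fin_cases kk <;> simp [hLM, Fin.sum_univ_three] ⟩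
    · exact ⟨(Finsupp.single 0 1 : Fin 3 →₀ ℕ), by ext kk; fin_cases kk <;> simp [hLM, Fin.sum_univ_three] ⟩
    · exact ⟨(Finsupp.single 0 2 + Finsupp.single 1 3 : Fin 3 →₀ ℕ), by ext kk; fin_cases kk <;> simp [hLM, Fin.sum_univ_three] ⟩
    · exact ⟨(Finsupp.single 0 1 + Finsupp.single 1 1 + Finsupp.single 2 1 : Fin 3 →₀ ℕ), by ext kk; fin_cases kk <;> simp [hLM, Fin.sum_univ_three] ⟩
    · exact ⟨(Finsupp.single 0 1 + Finsupp.single 1 1 : Fin 3 →₀ ℕ), by ext kk; fin_cases kk <;> simp [hLM, Fin.sum_univ_three] ⟩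
    · exact ⟨(Finsupp.single 0 1 + Finsupp.single 2 2 : Fin 3 →₀ ℕ), by ext kk; fin_cases kk <;> simp [hLM, Fin.sum_univ_three] ⟩
    · exact ⟨(Finsupp.single 0 1 + Finsupp.single 2 1 : Fin 3 →₀ ℕ), by ext kk; fin_cases kk <;> simp [hLM, Fin.sum_univ_three] ⟩
  · rintro g (rfl | rfl | rfl | rfl | rfl | rfl | rfl)
    · exact ⟨(Finsupp.single 2 3 : Fin 3 →₀ ℕ), by ext kk; fin_cases kk <;> simp [hLM, Fin.sum_univ_three, hgen1] ⟩
    · exact ⟨0, by rw [map_zero, hgen1, sub_self]⟩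
    · exact ⟨(Finsupp.single 0 1 + Finsupp.single 1 3 : Fin 3 →₀ ℕ), by ext kk; fin_cases kk <;> simp [hLM, Fin.sum_univ_three, hgen1] ⟩
    · exact ⟨(Finsupp.single 1 1 + Finsupp.single 2 1 : Fin 3 →₀ ℕ), by ext kk; fin_cases kk <;> simp [hLM, Fin.sum_univ_three, hgen1] ⟩
    · exact ⟨(Finsupp.single 1 1 : Fin 3 →₀ ℕ), by ext kk; fin_cases kk <;> simp [hLM, Fin.sum_univ_three, hgen1] ⟩
    · exact ⟨(Finsupp.single 2 2 : Fin 3 →₀ ℕ), by ext kk; fin_cases kk <;> simp [hLM, Fin.sum_univ_three, hgen1] ⟩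
    · exact ⟨(Finsupp.single 2 1 : Fin 3 →₀ ℕ), by ext kk; fin_cases kk <;> simp [hLM, Fin.sum_univ_three, hgen1] ⟩
  · intro i
    fin_cases i
    · refine ⟨gen 1, 0, Fin.elim0, fun l => l.elim0, ?_⟩
      rw [Finset.univ_eq_empty, Finset.sum_empty, add_zero]
      ext kk; fin_cases kk <;> simp [hLM, Fin.sum_univ_three, hgen1]
    · refine ⟨0, 1, ![gen 4], fun l => by fin_cases l; exact hgen0' _, ?_⟩
      rw [Fin.sum_univ_one]
      ext kk; fin_cases kk <;> simp [hLM, Fin.sum_univ_three, hgen1, hgen4]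
    · refine ⟨0, 1, ![gen 6], fun l => by fin_cases l; exact hgen0' _, ?_⟩
      rw [Fin.sum_univ_one]
      ext kk; fin_cases kk <;> simp [hLM, Fin.sum_univ_three, hgen1, hgen6]

/-- **The vertex chart of `1/3(1,1,2)` at `(0,0,3)`**: free, basis `[[0, 0, 3], [1, 0, -2], [0, 1, -2]]`. [folklore; cite: CoxLittleSchenck2011, §1.2] -/
theorem chart_c (P : AddSubmonoid (Fin 3 →₀ ℕ)) (hGP : AddSubmonoid.closure G7 = P) (gen : Fin 7 → ↥P)
    (_hgen0 : ((gen 0 : ↥P) : Fin 3 →₀ ℕ) = (Finsupp.single 0 3 : Fin 3 →₀ ℕ))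
    (_hgen1 : ((gen 1 : ↥P) : Fin 3 →₀ ℕ) = (Finsupp.single 1 3 : Fin 3 →₀ ℕ))
    (hgen2 : ((gen 2 : ↥P) : Fin 3 →₀ ℕ) = (Finsupp.single 2 3 : Fin 3 →₀ ℕ))
    (hgen3 : ((gen 3 : ↥P) : Fin 3 →₀ ℕ) = (Finsupp.single 0 1 + Finsupp.single 2 1 : Fin 3 →₀ ℕ))
    (hgen4 : ((gen 4 : ↥P) : Fin 3 →₀ ℕ) = (Finsupp.single 1 1 + Finsupp.single 2 1 : Fin 3 →₀ ℕ))
    (_hgen5 : ((gen 5 : ↥P) : Fin 3 →₀ ℕ) = (Finsupp.single 0 2 + Finsupp.single 1 1 : Fin 3 →₀ ℕ))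
    (_hgen6 : ((gen 6 : ↥P) : Fin 3 →₀ ℕ) = (Finsupp.single 0 1 + Finsupp.single 1 2 : Fin 3 →₀ ℕ))
    (hgen0' : ∀ j, gen j ≠ 0) :
    ∃ (n' : ℕ) (Q : AddSubmonoid (Fin n' →₀ ℕ)) (ι : ↥Q →+ (Fin 3 →₀ ℤ)) (_ : Function.Injective ι)
      (_ : ∀ e : ↥P, e ≠ 0 → ∃ u : ↥Q, ι u = toZ[3] (e : Fin 3 →₀ ℕ) - toZ[3] ((gen 2 : ↥P) : Fin 3 →₀ ℕ))
      (_ : ∀ p : ↥P, ∃ u : ↥Q, ι u = toZ[3] (p : Fin 3 →₀ ℕ))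
      (_ : ∀ u : ↥Q, ∃ (p : ↥P) (r : ℕ) (e : Fin r → ↥P), (∀ i, e i ≠ 0) ∧
        ι u = toZ[3] (p : Fin 3 →₀ ℕ) + ∑ i, (toZ[3] ((e i : ↥P) : Fin 3 →₀ ℕ) - toZ[3] ((gen 2 : ↥P) : Fin 3 →₀ ℕ))),
      (∀ (κ : Type) [Field κ], IsRegularRing (AddMonoidAlgebra κ ↥Q)) ∨
      ∃ (GQ : Set (Fin n' →₀ ℕ)) (_ : GQ.Finite) (_ : (0 : Fin n' →₀ ℕ) ∉ GQ) (_ : AddSubmonoid.closure GQ = Q),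
        (∀ (κ : Type) [Field κ], ∀ u : ↥Q, (u : Fin n' →₀ ℕ) ∈ GQ →
          IsRegularRing (Localization.Away (AddMonoidAlgebra.single u (1 : κ)))) ∧
        (∀ (K : Type) [Field K], Scheme.IsRegular (affineBlowup (Ideal.span {w : ↥(Algebra.adjoin K
          ((fun d : Fin n' →₀ ℕ => MvPolynomial.monomial d (1 : K)) '' GQ)) |
          ∃ d ∈ GQ, (w : MvPolynomial (Fin n') K) = MvPolynomial.monomial d 1}))) := by
  obtain ⟨L, hLM⟩ := exists_matrixHom (n := 3) (n' := 3) ![![0, 0, 3], ![1, 0, -2], ![0, 1, -2]]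
  have hLinj : Function.Injective L := by
    intro u u' h
    have h0 := DFunLike.congr_fun h 0
    have h1 := DFunLike.congr_fun h 1
    have h2 := DFunLike.congr_fun h 2
    simp [hLM, Fin.sum_univ_three] at h0 h1 h2
    have e0 : u 0 = u' 0 := by omega
    have e1 : u 1 = u' 1 := by omega
    have e2 : u 2 = u' 2 := by omega
    ext kk
    fin_cases kk
    exacts [e0, e1, e2]
  refine freeChart_of_matrixHom P G7 hGP (gen 2) L hLinj ?_ ?_ ?_
  · rintro g (rfl | rfl | rfl | rfl | rfl | rfl | rfl)
    · exact ⟨(Finsupp.single 0 2 + Finsupp.single 1 3 : Fin 3 →₀ ℕ), by ext kk; fin_cases kk <;> simp [hLM, Fin.sum_univ_three] ⟩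
    · exact ⟨(Finsupp.single 0 2 + Finsupp.single 2 3 : Fin 3 →₀ ℕ), by ext kk; fin_cases kk <;> simp [hLM, Fin.sum_univ_three] ⟩
    · exact ⟨(Finsupp.single 0 1 : Fin 3 →₀ ℕ), by ext kk; fin_cases kk <;> simp [hLM, Fin.sum_univ_three] ⟩
    · exact ⟨(Finsupp.single 0 1 + Finsupp.single 1 1 : Fin 3 →₀ ℕ), by ext kk; fin_cases kk <;> simp [hLM, Fin.sum_univ_three] ⟩
    · exact ⟨(Finsupp.single 0 1 + Finsupp.single 2 1 : Fin 3 →₀ ℕ), by ext kk; fin_cases kk <;> simp [hLM, Fin.sum_univ_three] ⟩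
    · exact ⟨(Finsupp.single 0 2 + Finsupp.single 1 2 + Finsupp.single 2 1 : Fin 3 →₀ ℕ), by ext kk; fin_cases kk <;> simp [hLM, Fin.sum_univ_three] ⟩
    · exact ⟨(Finsupp.single 0 2 + Finsupp.single 1 1 + Finsupp.single 2 2 : Fin 3 →₀ ℕ), by ext kk; fin_cases kk <;> simp [hLM, Fin.sum_univ_three] ⟩
  · rintro g (rfl | rfl | rfl | rfl | rfl | rfl | rfl)
    · exact ⟨(Finsupp.single 0 1 + Finsupp.single 1 3 : Fin 3 →₀ ℕ), by ext kk; fin_cases kk <;> simp [hLM, Fin.sum_univ_three, hgen2] ⟩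
    · exact ⟨(Finsupp.single 0 1 + Finsupp.single 2 3 : Fin 3 →₀ ℕ), by ext kk; fin_cases kk <;> simp [hLM, Fin.sum_univ_three, hgen2] ⟩
    · exact ⟨0, by rw [map_zero, hgen2, sub_self]⟩
    · exact ⟨(Finsupp.single 1 1 : Fin 3 →₀ ℕ), by ext kk; fin_cases kk <;> simp [hLM, Fin.sum_univ_three, hgen2] ⟩
    · exact ⟨(Finsupp.single 2 1 : Fin 3 →₀ ℕ), by ext kk; fin_cases kk <;> simp [hLM, Fin.sum_univ_three, hgen2] ⟩
    · exact ⟨(Finsupp.single 0 1 + Finsupp.single 1 2 + Finsupp.single 2 1 : Fin 3 →₀ ℕ), by ext kk; fin_cases kk <;> simp [hLM, Fin.sum_univ_three, hgen2] ⟩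
    · exact ⟨(Finsupp.single 0 1 + Finsupp.single 1 1 + Finsupp.single 2 2 : Fin 3 →₀ ℕ), by ext kk; fin_cases kk <;> simp [hLM, Fin.sum_univ_three, hgen2] ⟩
  · intro i
    fin_cases i
    · refine ⟨gen 2, 0, Fin.elim0, fun l => l.elim0, ?_⟩
      rw [Finset.univ_eq_empty, Finset.sum_empty, add_zero]
      ext kk; fin_cases kk <;> simp [hLM, Fin.sum_univ_three, hgen2]
    · refine ⟨0, 1, ![gen 3], fun l => by fin_cases l; exact hgen0' _, ?_⟩
      rw [Fin.sum_univ_one]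
      ext kk; fin_cases kk <;> simp [hLM, Fin.sum_univ_three, hgen2, hgen3]
    · refine ⟨0, 1, ![gen 4], fun l => by fin_cases l; exact hgen0' _, ?_⟩
      rw [Fin.sum_univ_one]
      ext kk; fin_cases kk <;> simp [hLM, Fin.sum_univ_three, hgen2, hgen4]

/-- **The vertex chart of `1/3(1,1,2)` at `(1,0,1)`**: free, basis `[[2, 0, -1], [-1, 0, 2], [-1, 1, 0]]`. [folklore; cite: CoxLittleSchenck2011, §1.2] -/
theorem chart_d (P : AddSubmonoid (Fin 3 →₀ ℕ)) (hGP : AddSubmonoid.closure G7 = P) (gen : Fin 7 → ↥P)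
    (hgen0 : ((gen 0 : ↥P) : Fin 3 →₀ ℕ) = (Finsupp.single 0 3 : Fin 3 →₀ ℕ))
    (_hgen1 : ((gen 1 : ↥P) : Fin 3 →₀ ℕ) = (Finsupp.single 1 3 : Fin 3 →₀ ℕ))
    (hgen2 : ((gen 2 : ↥P) : Fin 3 →₀ ℕ) = (Finsupp.single 2 3 : Fin 3 →₀ ℕ))
    (hgen3 : ((gen 3 : ↥P) : Fin 3 →₀ ℕ) = (Finsupp.single 0 1 + Finsupp.single 2 1 : Fin 3 →₀ ℕ))
    (hgen4 : ((gen 4 : ↥P) : Fin 3 →₀ ℕ) = (Finsupp.single 1 1 + Finsupp.single 2 1 : Fin 3 →₀ ℕ))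
    (_hgen5 : ((gen 5 : ↥P) : Fin 3 →₀ ℕ) = (Finsupp.single 0 2 + Finsupp.single 1 1 : Fin 3 →₀ ℕ))
    (_hgen6 : ((gen 6 : ↥P) : Fin 3 →₀ ℕ) = (Finsupp.single 0 1 + Finsupp.single 1 2 : Fin 3 →₀ ℕ))
    (hgen0' : ∀ j, gen j ≠ 0) :
    ∃ (n' : ℕ) (Q : AddSubmonoid (Fin n' →₀ ℕ)) (ι : ↥Q →+ (Fin 3 →₀ ℤ)) (_ : Function.Injective ι)
      (_ : ∀ e : ↥P, e ≠ 0 → ∃ u : ↥Q, ι u = toZ[3] (e : Fin 3 →₀ ℕ) - toZ[3] ((gen 3 : ↥P) : Fin 3 →₀ ℕ))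
      (_ : ∀ p : ↥P, ∃ u : ↥Q, ι u = toZ[3] (p : Fin 3 →₀ ℕ))
      (_ : ∀ u : ↥Q, ∃ (p : ↥P) (r : ℕ) (e : Fin r → ↥P), (∀ i, e i ≠ 0) ∧
        ι u = toZ[3] (p : Fin 3 →₀ ℕ) + ∑ i, (toZ[3] ((e i : ↥P) : Fin 3 →₀ ℕ) - toZ[3] ((gen 3 : ↥P) : Fin 3 →₀ ℕ))),
      (∀ (κ : Type) [Field κ], IsRegularRing (AddMonoidAlgebra κ ↥Q)) ∨
      ∃ (GQ : Set (Fin n' →₀ ℕ)) (_ : GQ.Finite) (_ : (0 : Fin n' →₀ ℕ) ∉ GQ) (_ : AddSubmonoid.closure GQ = Q),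
        (∀ (κ : Type) [Field κ], ∀ u : ↥Q, (u : Fin n' →₀ ℕ) ∈ GQ →
          IsRegularRing (Localization.Away (AddMonoidAlgebra.single u (1 : κ)))) ∧
        (∀ (K : Type) [Field K], Scheme.IsRegular (affineBlowup (Ideal.span {w : ↥(Algebra.adjoin K
          ((fun d : Fin n' →₀ ℕ => MvPolynomial.monomial d (1 : K)) '' GQ)) |
          ∃ d ∈ GQ, (w : MvPolynomial (Fin n') K) = MvPolynomial.monomial d 1}))) := by
  obtain ⟨L, hLM⟩ := exists_matrixHom (n := 3) (n' := 3) ![![2, 0, -1], ![-1, 0, 2], ![-1, 1, 0]]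
  have hLinj : Function.Injective L := by
    intro u u' h
    have h0 := DFunLike.congr_fun h 0
    have h1 := DFunLike.congr_fun h 1
    have h2 := DFunLike.congr_fun h 2
    simp [hLM, Fin.sum_univ_three] at h0 h1 h2
    have e0 : u 0 = u' 0 := by omega
    have e1 : u 1 = u' 1 := by omega
    have e2 : u 2 = u' 2 := by omega
    ext kk
    fin_cases kk
    exacts [e0, e1, e2]
  refine freeChart_of_matrixHom P G7 hGP (gen 3) L hLinj ?_ ?_ ?_
  · rintro g (rfl | rfl | rfl | rfl | rfl | rfl | rfl)
    · exact ⟨(Finsupp.single 0 2 + Finsupp.single 1 1 : Fin 3 →₀ ℕ), by ext kk; fin_cases kk <;> simp [hLM, Fin.sum_univ_three] ⟩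
    · exact ⟨(Finsupp.single 0 2 + Finsupp.single 1 1 + Finsupp.single 2 3 : Fin 3 →₀ ℕ), by ext kk; fin_cases kk <;> simp [hLM, Fin.sum_univ_three] ⟩
    · exact ⟨(Finsupp.single 0 1 + Finsupp.single 1 2 : Fin 3 →₀ ℕ), by ext kk; fin_cases kk <;> simp [hLM, Fin.sum_univ_three] ⟩
    · exact ⟨(Finsupp.single 0 1 + Finsupp.single 1 1 : Fin 3 →₀ ℕ), by ext kk; fin_cases kk <;> simp [hLM, Fin.sum_univ_three] ⟩
    · exact ⟨(Finsupp.single 0 1 + Finsupp.single 1 1 + Finsupp.single 2 1 : Fin 3 →₀ ℕ), by ext kk; fin_cases kk <;> simp [hLM, Fin.sum_univ_three] ⟩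
    · exact ⟨(Finsupp.single 0 2 + Finsupp.single 1 1 + Finsupp.single 2 1 : Fin 3 →₀ ℕ), by ext kk; fin_cases kk <;> simp [hLM, Fin.sum_univ_three] ⟩
    · exact ⟨(Finsupp.single 0 2 + Finsupp.single 1 1 + Finsupp.single 2 2 : Fin 3 →₀ ℕ), by ext kk; fin_cases kk <;> simp [hLM, Fin.sum_univ_three] ⟩
  · rintro g (rfl | rfl | rfl | rfl | rfl | rfl | rfl)
    · exact ⟨(Finsupp.single 0 1 : Fin 3 →₀ ℕ), by ext kk; fin_cases kk <;> simp [hLM, Fin.sum_univ_three, hgen3] ⟩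
    · exact ⟨(Finsupp.single 0 1 + Finsupp.single 2 3 : Fin 3 →₀ ℕ), by ext kk; fin_cases kk <;> simp [hLM, Fin.sum_univ_three, hgen3] ⟩
    · exact ⟨(Finsupp.single 1 1 : Fin 3 →₀ ℕ), by ext kk; fin_cases kk <;> simp [hLM, Fin.sum_univ_three, hgen3] ⟩
    · exact ⟨0, by rw [map_zero, hgen3, sub_self]⟩
    · exact ⟨(Finsupp.single 2 1 : Fin 3 →₀ ℕ), by ext kk; fin_cases kk <;> simp [hLM, Fin.sum_univ_three, hgen3] ⟩
    · exact ⟨(Finsupp.single 0 1 + Finsupp.single 2 1 : Fin 3 →₀ ℕ), by ext kk; fin_cases kk <;> simp [hLM, Fin.sum_univ_three, hgen3] ⟩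
    · exact ⟨(Finsupp.single 0 1 + Finsupp.single 2 2 : Fin 3 →₀ ℕ), by ext kk; fin_cases kk <;> simp [hLM, Fin.sum_univ_three, hgen3] ⟩
  · intro i
    fin_cases i
    · refine ⟨0, 1, ![gen 0], fun l => by fin_cases l; exact hgen0' _, ?_⟩
      rw [Fin.sum_univ_one]
      ext kk; fin_cases kk <;> simp [hLM, Fin.sum_univ_three, hgen3, hgen0]
    · refine ⟨0, 1, ![gen 2], fun l => by fin_cases l; exact hgen0' _, ?_⟩
      rw [Fin.sum_univ_one]
      ext kk; fin_cases kk <;> simp [hLM, Fin.sum_univ_three, hgen3, hgen2]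
    · refine ⟨0, 1, ![gen 4], fun l => by fin_cases l; exact hgen0' _, ?_⟩
      rw [Fin.sum_univ_one]
      ext kk; fin_cases kk <;> simp [hLM, Fin.sum_univ_three, hgen3, hgen4]

/-- **The vertex chart of `1/3(1,1,2)` at `(0,1,1)`**: free, basis `[[0, 2, -1], [0, -1, 2], [1, -1, 0]]`. [folklore; cite: CoxLittleSchenck2011, §1.2] -/
theorem chart_e (P : AddSubmonoid (Fin 3 →₀ ℕ)) (hGP : AddSubmonoid.closure G7 = P) (gen : Fin 7 → ↥P)
    (_hgen0 : ((gen 0 : ↥P) : Fin 3 →₀ ℕ) = (Finsupp.single 0 3 : Fin 3 →₀ ℕ))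
    (hgen1 : ((gen 1 : ↥P) : Fin 3 →₀ ℕ) = (Finsupp.single 1 3 : Fin 3 →₀ ℕ))
    (hgen2 : ((gen 2 : ↥P) : Fin 3 →₀ ℕ) = (Finsupp.single 2 3 : Fin 3 →₀ ℕ))
    (hgen3 : ((gen 3 : ↥P) : Fin 3 →₀ ℕ) = (Finsupp.single 0 1 + Finsupp.single 2 1 : Fin 3 →₀ ℕ))
    (hgen4 : ((gen 4 : ↥P) : Fin 3 →₀ ℕ) = (Finsupp.single 1 1 + Finsupp.single 2 1 : Fin 3 →₀ ℕ))
    (_hgen5 : ((gen 5 : ↥P) : Fin 3 →₀ ℕ) = (Finsupp.single 0 2 + Finsupp.single 1 1 : Fin 3 →₀ ℕ))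
    (_hgen6 : ((gen 6 : ↥P) : Fin 3 →₀ ℕ) = (Finsupp.single 0 1 + Finsupp.single 1 2 : Fin 3 →₀ ℕ))
    (hgen0' : ∀ j, gen j ≠ 0) :
    ∃ (n' : ℕ) (Q : AddSubmonoid (Fin n' →₀ ℕ)) (ι : ↥Q →+ (Fin 3 →₀ ℤ)) (_ : Function.Injective ι)
      (_ : ∀ e : ↥P, e ≠ 0 → ∃ u : ↥Q, ι u = toZ[3] (e : Fin 3 →₀ ℕ) - toZ[3] ((gen 4 : ↥P) : Fin 3 →₀ ℕ))
      (_ : ∀ p : ↥P, ∃ u : ↥Q, ι u = toZ[3] (p : Fin 3 →₀ ℕ))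
      (_ : ∀ u : ↥Q, ∃ (p : ↥P) (r : ℕ) (e : Fin r → ↥P), (∀ i, e i ≠ 0) ∧
        ι u = toZ[3] (p : Fin 3 →₀ ℕ) + ∑ i, (toZ[3] ((e i : ↥P) : Fin 3 →₀ ℕ) - toZ[3] ((gen 4 : ↥P) : Fin 3 →₀ ℕ))),
      (∀ (κ : Type) [Field κ], IsRegularRing (AddMonoidAlgebra κ ↥Q)) ∨
      ∃ (GQ : Set (Fin n' →₀ ℕ)) (_ : GQ.Finite) (_ : (0 : Fin n' →₀ ℕ) ∉ GQ) (_ : AddSubmonoid.closure GQ = Q),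
        (∀ (κ : Type) [Field κ], ∀ u : ↥Q, (u : Fin n' →₀ ℕ) ∈ GQ →
          IsRegularRing (Localization.Away (AddMonoidAlgebra.single u (1 : κ)))) ∧
        (∀ (K : Type) [Field K], Scheme.IsRegular (affineBlowup (Ideal.span {w : ↥(Algebra.adjoin K
          ((fun d : Fin n' →₀ ℕ => MvPolynomial.monomial d (1 : K)) '' GQ)) |
          ∃ d ∈ GQ, (w : MvPolynomial (Fin n') K) = MvPolynomial.monomial d 1}))) := by
  obtain ⟨L, hLM⟩ := exists_matrixHom (n := 3) (n' := 3) ![![0, 2, -1], ![0, -1, 2], ![1, -1, 0]]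
  have hLinj : Function.Injective L := by
    intro u u' h
    have h0 := DFunLike.congr_fun h 0
    have h1 := DFunLike.congr_fun h 1
    have h2 := DFunLike.congr_fun h 2
    simp [hLM, Fin.sum_univ_three] at h0 h1 h2
    have e0 : u 0 = u' 0 := by omega
    have e1 : u 1 = u' 1 := by omega
    have e2 : u 2 = u' 2 := by omega
    ext kk
    fin_cases kk
    exacts [e0, e1, e2]
  refine freeChart_of_matrixHom P G7 hGP (gen 4) L hLinj ?_ ?_ ?_
  · rintro g (rfl | rfl | rfl | rfl | rfl | rfl | rfl)
    · exact ⟨(Finsupp.single 0 2 + Finsupp.single 1 1 + Finsupp.single 2 3 : Fin 3 →₀ ℕ), by ext kk; fin_cases kk <;> simp [hLM, Fin.sum_univ_three] ⟩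
    · exact ⟨(Finsupp.single 0 2 + Finsupp.single 1 1 : Fin 3 →₀ ℕ), by ext kk; fin_cases kk <;> simp [hLM, Fin.sum_univ_three] ⟩
    · exact ⟨(Finsupp.single 0 1 + Finsupp.single 1 2 : Fin 3 →₀ ℕ), by ext kk; fin_cases kk <;> simp [hLM, Fin.sum_univ_three] ⟩
    · exact ⟨(Finsupp.single 0 1 + Finsupp.single 1 1 + Finsupp.single 2 1 : Fin 3 →₀ ℕ), by ext kk; fin_cases kk <;> simp [hLM, Fin.sum_univ_three] ⟩
    · exact ⟨(Finsupp.single 0 1 + Finsupp.single 1 1 : Fin 3 →₀ ℕ), by ext kk; fin_cases kk <;> simp [hLM, Fin.sum_univ_three] ⟩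
    · exact ⟨(Finsupp.single 0 2 + Finsupp.single 1 1 + Finsupp.single 2 2 : Fin 3 →₀ ℕ), by ext kk; fin_cases kk <;> simp [hLM, Fin.sum_univ_three] ⟩
    · exact ⟨(Finsupp.single 0 2 + Finsupp.single 1 1 + Finsupp.single 2 1 : Fin 3 →₀ ℕ), by ext kk; fin_cases kk <;> simp [hLM, Fin.sum_univ_three] ⟩
  · rintro g (rfl | rfl | rfl | rfl | rfl | rfl | rfl)
    · exact ⟨(Finsupp.single 0 1 + Finsupp.single 2 3 : Fin 3 →₀ ℕ), by ext kk; fin_cases kk <;> simp [hLM, Fin.sum_univ_three, hgen4] ⟩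
    · exact ⟨(Finsupp.single 0 1 : Fin 3 →₀ ℕ), by ext kk; fin_cases kk <;> simp [hLM, Fin.sum_univ_three, hgen4] ⟩
    · exact ⟨(Finsupp.single 1 1 : Fin 3 →₀ ℕ), by ext kk; fin_cases kk <;> simp [hLM, Fin.sum_univ_three, hgen4] ⟩
    · exact ⟨(Finsupp.single 2 1 : Fin 3 →₀ ℕ), by ext kk; fin_cases kk <;> simp [hLM, Fin.sum_univ_three, hgen4] ⟩
    · exact ⟨0, by rw [map_zero, hgen4, sub_self]⟩
    · exact ⟨(Finsupp.single 0 1 + Finsupp.single 2 2 : Fin 3 →₀ ℕ), by ext kk; fin_cases kk <;> simp [hLM, Fin.sum_univ_three, hgen4] ⟩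
    · exact ⟨(Finsupp.single 0 1 + Finsupp.single 2 1 : Fin 3 →₀ ℕ), by ext kk; fin_cases kk <;> simp [hLM, Fin.sum_univ_three, hgen4] ⟩
  · intro i
    fin_cases i
    · refine ⟨0, 1, ![gen 1], fun l => by fin_cases l; exact hgen0' _, ?_⟩
      rw [Fin.sum_univ_one]
      ext kk; fin_cases kk <;> simp [hLM, Fin.sum_univ_three, hgen4, hgen1]
    · refine ⟨0, 1, ![gen 2], fun l => by fin_cases l; exact hgen0' _, ?_⟩
      rw [Fin.sum_univ_one]
      ext kk; fin_cases kk <;> simp [hLM, Fin.sum_univ_three, hgen4, hgen2]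
    · refine ⟨0, 1, ![gen 3], fun l => by fin_cases l; exact hgen0' _, ?_⟩
      rw [Fin.sum_univ_one]
      ext kk; fin_cases kk <;> simp [hLM, Fin.sum_univ_three, hgen4, hgen3]

end Summit.ResolutionOfSingularities.ResolutionOfSingularities.Theorems.FRationalResolution.ClassOneThird112

end
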